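import Summits.QuantumAdvantage.AdviceFreeQNC0.AffBells22WalkHardAllSubcube
import Summits.QuantumAdvantage.AdviceFreeQNC0.OddPrimeTransport
import Summits.QuantumAdvantage.AdviceFreeQNC0.RingHardOdd
import Summits.QuantumAdvantage.AdviceFreeQNC0.AffBells22FrameJunta
import HarnessLib

/-!
# Sketch23 §3 (planner qn-p1 g23, ROUND-22 §1; ask P-23b): the RING side of gap (G1) — statements and transport lemmas

Verbatim copy of `HOME/qa-qnc0-p1/exp23/Sketch23.lean` §3 and the first half of §3b (landing ask P-23b; authored by the
planner seat qn-p1 g23, landed by qn-prover-3 g12; only this header and three one-line docstrings are new, and the helper `log_succ_le` is inlined into `degBook` — it duplicates the tree's `Literature.Computability.Cryptography.log_two_succ_le`).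

* `RingHardOddCond2 δ₀` — `RingHardOdd 2` for strategies that are polylog-degree `𝔽₂`-polynomials on every subcube
  `{x_W = a}`, `|W| ≤ δ₀ n`;
* `RingCondOfSubcube` : `(∀ δ₁ < 1, WalkHardAllSubcube δ₁) → ∀ δ₀ < 1/2, RingHardOddCond2 δ₀` (its hypothesis is the tree
  theorem `walkHardAllSubcube`, `ringCondOfSubcube_hyp`);
* `JuntaCommonHard2` (junta ⊕ COMMON linear set, every `δ₀ < 1/2`), `JuntaCommonOfCond`, `G1Chain` / `g1Chain`;
* namespace `RingCond`: the shadow set `uShadow W` of u-coordinates read by `x|_W`, `xOfU_congr`, `aOf`, the merge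
  lemmas (`xOfU_merge_of_mem`, `merge_aOf_xOfU`, `hasDeg_comp_merge`, `merge_merge`, the involution `mergeSwap`,
  `sum_card_filter_merge`), and the degree bookkeeping `degBook`.

The proofs `RingCond.ringCondOfSubcube`, `RingCond.juntaCommonOfCond` and the unconditional `juntaCommonHard2`,
`ringHardOddCond2` are in `AffBells23RingCondProofs`.  Nothing here touches the crux; separation NOT moved.
-/

noncomputable section

open Classical

namespace Summit.QuantumAdvantage.AdviceFreeQNC0

open Finset
open Literature.Computability.QuantumComplexity Literature.Computability.QuantumComplexity.RingHLF
open Literature.Computability.MetaComplexity Literature.Computability.MetaComplexity.Smolensky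
open F4 TubePlanProof AffBells22

namespace AffBells23
/-! ## §3 The RING side: conditioning on `x_W`, `|W| ≤ δ₀(n+1)`, `δ₀ < 1/2` -/

/-- **`RingHardOddCond2 δ₀`** — `RingHardOdd 2` for strategies that are polylog-degree `𝔽₂`-polynomials on every subcube `{x_W = a}` of the
input (arbitrary dependence on `x_W`), `|W| ≤ δ₀ n`.  `W = ∅` is `RingHardOdd 2`. -/
def RingHardOddCond2 (δ₀ : ℝ) : Prop :=
  ∃ θ : ℝ, θ < 1 ∧ ∀ C : ℕ, ∃ n₀ : ℕ, ∀ n ≥ n₀, ∀ (W : Finset (Fin n)) (P : Fin n → CubeFn (ZMod 2) n),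
    (W.card : ℝ) ≤ δ₀ * n →
    (∀ (a : Fin n → Bool) (i : Fin n), (fun x => P i (subcubeMerge W a x)) ∈ lowDeg (ZMod 2) n ((Nat.log 2 n) ^ C)) →
      ((univ.filter fun x : Fin n → Bool => OddZeros x ∧ Rel x (fun i => decide (P i x = 1))).card : ℝ) ≤ θ * (2 : ℝ) ^ (n - 1)

/-- **`RingCondOfSubcube`** (PROVED in §3b, `RingCond.ringCondOfSubcube`; re-run of `walkTransportF` fibrewise): partition the u-cube `{0,1}^n` (`N = n+1`) by `u|_S`,
`S := {j−1, j : j ∈ W} ∩ [0,n)` (`|S| ≤ 2|W| ≤ 2δ₀N < n` for `δ₀ < 1/2`, `N` large); on each part `xOfU u |_W` is CONSTANT (`xOfU u j` reads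
`u_{j−1}, u_j` only), so the transported strategy `y_g = [P_g ∘ xOfU = 1] ⊕ tGuess_g ∘ xOfU` is polylog-degree in the free bits
(`hasDegF_transport` on the subcube); apply `WalkHardAllSubcube (2δ₀/(1−o(1)))` per part and sum the `2^{|S|}` bounds; inject the odd class by `uVec`. -/
def RingCondOfSubcube : Prop := (∀ δ₁ : ℝ, δ₁ < 1 → WalkHardAllSubcube δ₁) → ∀ δ₀ : ℝ, δ₀ < 1 / 2 → RingHardOddCond2 δ₀

/-- the hypothesis of `RingCondOfSubcube` is the tree theorem `walkHardAllSubcube`. -/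
theorem ringCondOfSubcube_hyp : ∀ δ₁ : ℝ, δ₁ < 1 → WalkHardAllSubcube δ₁ := fun _ h => walkHardAllSubcube h

/-! (`ReadsOnly`, `winCount` are the TREE's `AffBells22.ReadsOnly`, `AffBells22.winCount` — `AffBells22FrameJunta.lean`.) -/

/-- **`JuntaCommonHard2`** = Sketch22's (G1) `JuntaHardConditioned` with `∀ δ₀ < 1/2` in place of `∃ δ₀ > 0` and ONE `θ` for all `w₀, δ₀`:
`w₀`-junta strategies that in addition read a COMMON set `W` of `≤ δ₀N` inputs have value `≤ θ`; `θ` is quantified AFTER `δ₀` (that is what an abstract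
`RingHardOddCond2 δ₀` hypothesis gives; along the actual chain `θ = θ(walkHardF_two)` for every `δ₀`) and is uniform in `w₀`. -/
def JuntaCommonHard2 : Prop :=
  ∀ δ₀ : ℝ, δ₀ < 1 / 2 → ∃ θ : ℝ, θ < 1 ∧ ∀ w₀ : ℕ, ∃ n₀ : ℕ, ∀ N ≥ n₀,
    ∀ (W : Finset (Fin N)) (T : Fin N → Finset (Fin N)) (g : Fin N → (Fin N → Bool) → Bool),
      (W.card : ℝ) ≤ δ₀ * N → (∀ k, (T k).card ≤ w₀) → (∀ k, ReadsOnly (T k ∪ W) (g k)) →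
        (winCount (fun x k => g k x) : ℝ) ≤ θ * (2 : ℝ) ^ (N - 1)

/-- **`JuntaCommonOfCond`** (PROVED in §3b, `RingCond.juntaCommonOfCond`): a `(T_k ∪ W)`-reader restricted to `{x_W = a}` is a `w₀`-junta of the free bits, i.e. an
`𝔽₂`-polynomial of degree `≤ w₀ ≤ log₂ N`; so `RingHardOddCond2 δ₀` (all `δ₀ < 1/2`) gives `JuntaCommonHard2` with the same `θ`. -/
def JuntaCommonOfCond : Prop := (∀ δ₀ : ℝ, δ₀ < 1 / 2 → RingHardOddCond2 δ₀) → JuntaCommonHard2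

/-- The remaining (G1) chain, as one statement over the two ring-side targets. -/
def G1Chain : Prop := RingCondOfSubcube → JuntaCommonOfCond → JuntaCommonHard2

/-- `G1Chain` holds (PROVED: composition with the tree theorem `walkHardAllSubcube`). -/
theorem g1Chain : G1Chain := fun hRing hJ => hJ (hRing ringCondOfSubcube_hyp)

/-! ## §3b PROOFS of the ring side: `ringCondOfSubcube`, `juntaCommonOfCond`, hence `juntaCommonHard2` UNCONDITIONALLY -/

namespace RingCond

/-- Degree bookkeeping (copy of the private `degree_bookkeepingF` of `OddPrimeTransport`): for `n ≥ 4^{p+1}`,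
`(p−1)·(log₂ (n+1))^c·2 + 4 ≤ (log₂ n)^{2c+1}`. -/
theorem degBook {p : ℕ} (hp : 2 ≤ p) {n : ℕ} (hn : 4 ^ (p + 1) ≤ n) (c : ℕ) :
    (p - 1) * (Nat.log 2 (n + 1)) ^ c * 2 + 2 * 2 ≤ (Nat.log 2 n) ^ (2 * c + 1) := by
  have h4 : (4 : ℕ) ^ (p + 1) = 2 ^ (2 * p + 2) := by
    rw [show 2 * p + 2 = 2 * (p + 1) by ring, pow_mul]
    norm_num
  have hlog : 2 * p + 2 ≤ Nat.log 2 n :=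
    Nat.le_log_of_pow_le (by norm_num) (by rw [← h4]; exact hn)
  have hL2 : 2 ≤ Nat.log 2 n := by omega
  have h1 : Nat.log 2 (n + 1) ≤ Nat.log 2 n * Nat.log 2 n := by
    -- `log₂ (n+1) ≤ log₂ n + 1` (the tree's `Literature.Computability.Cryptography.log_two_succ_le`, inlined to keep imports light)
    have : Nat.log 2 (n + 1) ≤ Nat.log 2 n + 1 :=
      calc Nat.log 2 (n + 1) ≤ Nat.log 2 (2 ^ (Nat.log 2 n + 1)) :=
            Nat.log_mono_right (Nat.lt_pow_succ_log_self (by norm_num) n)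
        _ = Nat.log 2 n + 1 := Nat.log_pow (by norm_num) _
    nlinarith
  have hc : (Nat.log 2 (n + 1)) ^ c ≤ (Nat.log 2 n) ^ (2 * c) :=
    calc (Nat.log 2 (n + 1)) ^ c ≤ (Nat.log 2 n * Nat.log 2 n) ^ c := Nat.pow_le_pow_left h1 c
      _ = (Nat.log 2 n) ^ (2 * c) := by rw [← pow_two, ← pow_mul]
  have hone : 1 ≤ (Nat.log 2 n) ^ (2 * c) := Nat.one_le_pow _ _ (by omega)
  have hmul : (p - 1) * (Nat.log 2 (n + 1)) ^ c * 2 ≤ (p - 1) * (Nat.log 2 n) ^ (2 * c) * 2 :=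
    Nat.mul_le_mul_right _ (Nat.mul_le_mul_left _ hc)
  calc (p - 1) * (Nat.log 2 (n + 1)) ^ c * 2 + 2 * 2
      ≤ (p - 1) * (Nat.log 2 n) ^ (2 * c) * 2 + 2 * 2 * (Nat.log 2 n) ^ (2 * c) := by
        have : 2 * 2 ≤ 2 * 2 * (Nat.log 2 n) ^ (2 * c) := by nlinarith
        omega
    _ = (2 * (p - 1) + 4) * (Nat.log 2 n) ^ (2 * c) := by ring
    _ ≤ Nat.log 2 n * (Nat.log 2 n) ^ (2 * c) := Nat.mul_le_mul_right _ (by omega)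
    _ = (Nat.log 2 n) ^ (2 * c + 1) := by ring

variable {n : ℕ}

/-- The u-coordinates read by `xOfU · j` for `j ∈ W` (`x_j = ¬(u_j ⊕ u_{j−1})`): `{i : i.castSucc ∈ W ∨ i.succ ∈ W}`. -/
def uShadow (W : Finset (Fin (n + 1))) : Finset (Fin n) :=
  univ.filter fun i : Fin n => i.castSucc ∈ W ∨ i.succ ∈ W

/-- `|uShadow W| ≤ 2|W|`. -/
theorem card_uShadow_le (W : Finset (Fin (n + 1))) : (uShadow W).card ≤ 2 * W.card := by
  have h1 : (univ.filter fun i : Fin n => i.castSucc ∈ W).card ≤ W.card := by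
    refine Finset.card_le_card_of_injOn Fin.castSucc ?_ ?_
    · intro i hi
      rw [Finset.mem_coe, mem_filter] at hi
      exact hi.2
    · intro a _ b _ h
      exact Fin.castSucc_injective _ h
  have h2 : (univ.filter fun i : Fin n => i.succ ∈ W).card ≤ W.card := by
    refine Finset.card_le_card_of_injOn Fin.succ ?_ ?_
    · intro i hi
      rw [Finset.mem_coe, mem_filter] at hi
      exact hi.2
    · intro a _ b _ h
      exact Fin.succ_injective _ h
  have hsub : uShadow W ⊆ (univ.filter fun i : Fin n => i.castSucc ∈ W) ∪ (univ.filter fun i : Fin n => i.succ ∈ W) := by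
    intro i hi
    unfold uShadow at hi
    rw [mem_filter] at hi
    rw [mem_union, mem_filter, mem_filter]
    rcases hi.2 with h | h
    · exact Or.inl ⟨mem_univ _, h⟩
    · exact Or.inr ⟨mem_univ _, h⟩
  calc (uShadow W).card ≤ ((univ.filter fun i : Fin n => i.castSucc ∈ W) ∪ (univ.filter fun i : Fin n => i.succ ∈ W)).card :=
        card_le_card hsub
    _ ≤ (univ.filter fun i : Fin n => i.castSucc ∈ W).card + (univ.filter fun i : Fin n => i.succ ∈ W).card :=
        card_union_le _ _
    _ ≤ W.card + W.card := Nat.add_le_add h1 h2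
    _ = 2 * W.card := by ring

/-- `xOfU u j`, `j ∈ W`, depends on `u` only through `u |_(uShadow W)`. -/
theorem xOfU_congr (W : Finset (Fin (n + 1))) {u u' : Fin n → Bool}
    (h : ∀ i ∈ uShadow W, u i = u' i) {j : Fin (n + 1)} (hj : j ∈ W) : xOfU u j = xOfU u' j := by
  unfold xOfU
  have h1 : uExt u j.val = uExt u' j.val := by
    unfold uExt
    by_cases hjn : j.val < n
    · rw [dif_pos hjn, dif_pos hjn]
      apply h
      unfold uShadow
      rw [mem_filter]
      refine ⟨mem_univ _, Or.inl ?_⟩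
      have e : Fin.castSucc (⟨j.val, hjn⟩ : Fin n) = j := Fin.ext rfl
      rw [e]
      exact hj
    · rw [dif_neg hjn, dif_neg hjn]
  have h2 : (if j.val = 0 then false else uExt u (j.val - 1)) = (if j.val = 0 then false else uExt u' (j.val - 1)) := by
    by_cases hj0 : j.val = 0
    · rw [if_pos hj0, if_pos hj0]
    · rw [if_neg hj0, if_neg hj0]
      unfold uExt
      have hlt : j.val - 1 < n := by have := j.isLt; omega
      rw [dif_pos hlt, dif_pos hlt]
      apply h
      unfold uShadow
      rw [mem_filter]
      refine ⟨mem_univ _, Or.inr ?_⟩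
      have e : Fin.succ (⟨j.val - 1, hlt⟩ : Fin n) = j := Fin.ext (show j.val - 1 + 1 = j.val by omega)
      rw [e]
      exact hj
  rw [h1, h2]

/-- The ring inputs on `W` determined by the shadow bits `b`. -/
def aOf (W : Finset (Fin (n + 1))) (b : Fin n → Bool) : Fin (n + 1) → Bool :=
  xOfU (subcubeMerge (uShadow W) b b)

/-- On `W`, the ring input of a merged pattern is determined by the shadow bits. -/
theorem xOfU_merge_of_mem (W : Finset (Fin (n + 1))) (b u : Fin n → Bool) {j : Fin (n + 1)} (hj : j ∈ W) :
    xOfU (subcubeMerge (uShadow W) b u) j = aOf W b j :=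
  xOfU_congr W (fun i hi => by unfold subcubeMerge; rw [if_pos hi, if_pos hi]) hj

/-- On the part `{u |_S = b |_S}` the ring input lies in the subcube `{x_W = aOf W b}`. -/
theorem merge_aOf_xOfU (W : Finset (Fin (n + 1))) (b u : Fin n → Bool) :
    subcubeMerge W (aOf W b) (xOfU (subcubeMerge (uShadow W) b u)) = xOfU (subcubeMerge (uShadow W) b u) := by
  funext j
  show (if j ∈ W then aOf W b j else xOfU (subcubeMerge (uShadow W) b u) j) = _
  by_cases hj : j ∈ W
  · rw [if_pos hj, xOfU_merge_of_mem W b u hj]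
  · rw [if_neg hj]

/-- Degree does not grow under a subcube merge (every coordinate of `subcubeMerge S b` is a constant or a variable). -/
theorem hasDeg_comp_merge {m : ℕ} (S : Finset (Fin m)) (b : Fin m → Bool) {D : ℕ} {h : (Fin m → Bool) → Bool}
    (hh : HasDeg h D) : HasDeg (fun u => h (subcubeMerge S b u)) D := by
  unfold HasDeg at hh ⊢
  refine comp_mem_lowDeg_of_coord (F := ZMod 2) (subcubeMerge S b) (fun i => ?_) hh
  by_cases hi : i ∈ S
  · by_cases hb : b i = true
    · have e : (fun u : Fin m → Bool => if subcubeMerge S b u i = true then (1 : ZMod 2) else 0)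
          = mono (ZMod 2) (∅ : Finset (Fin m)) := by
        funext u
        unfold subcubeMerge
        rw [if_pos hi, if_pos hb, mono_empty]
        rfl
      rw [e]
      exact mono_mem_lowDeg (by simp)
    · have e : (fun u : Fin m → Bool => if subcubeMerge S b u i = true then (1 : ZMod 2) else 0) = 0 := by
        funext u
        unfold subcubeMerge
        rw [if_pos hi, if_neg hb]
        rfl
      rw [e]
      exact Submodule.zero_mem _
  · have e : (fun u : Fin m → Bool => if subcubeMerge S b u i = true then (1 : ZMod 2) else 0)
        = mono (ZMod 2) ({i} : Finset (Fin m)) := by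
      funext u
      rw [mono_apply]
      simp only [Finset.mem_singleton, forall_eq]
      unfold subcubeMerge
      rw [if_neg hi]
    rw [e]
    exact mono_mem_lowDeg (by simp)

/-- The merge involution: `merge_S (merge_S b u) (merge_S u b) = b`. -/
theorem merge_merge {m : ℕ} (S : Finset (Fin m)) (b u : Fin m → Bool) :
    subcubeMerge S (subcubeMerge S b u) (subcubeMerge S u b) = b := by
  funext i
  unfold subcubeMerge
  by_cases hi : i ∈ S
  · rw [if_pos hi, if_pos hi]
  · rw [if_neg hi, if_neg hi]

/-- The involution `(b, u) ↦ (merge_S b u, merge_S u b)` of pairs of points. -/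
def mergeSwap {m : ℕ} (S : Finset (Fin m)) : ((Fin m → Bool) × (Fin m → Bool)) ≃ ((Fin m → Bool) × (Fin m → Bool)) where
  toFun p := (subcubeMerge S p.1 p.2, subcubeMerge S p.2 p.1)
  invFun p := (subcubeMerge S p.1 p.2, subcubeMerge S p.2 p.1)
  left_inv p := by
    show (subcubeMerge S (subcubeMerge S p.1 p.2) (subcubeMerge S p.2 p.1),
      subcubeMerge S (subcubeMerge S p.2 p.1) (subcubeMerge S p.1 p.2)) = p
    rw [merge_merge, merge_merge]
  right_inv p := by
    show (subcubeMerge S (subcubeMerge S p.1 p.2) (subcubeMerge S p.2 p.1),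
      subcubeMerge S (subcubeMerge S p.2 p.1) (subcubeMerge S p.1 p.2)) = p
    rw [merge_merge, merge_merge]

/-- **Averaging over the parts**: `∑_b #{u : Q (merge_S b u)} = 2^m · #{v : Q v}`. -/
theorem sum_card_filter_merge {m : ℕ} (S : Finset (Fin m)) (Q : (Fin m → Bool) → Prop) [DecidablePred Q] :
    ∑ b : Fin m → Bool, (univ.filter fun u => Q (subcubeMerge S b u)).card = 2 ^ m * (univ.filter Q).card := by
  have h1 : ∑ b : Fin m → Bool, (univ.filter fun u => Q (subcubeMerge S b u)).card
      = ∑ p : (Fin m → Bool) × (Fin m → Bool), (if Q (subcubeMerge S p.1 p.2) then 1 else 0) := by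
    rw [Fintype.sum_prod_type]
    refine Finset.sum_congr rfl fun b _ => ?_
    rw [Finset.card_filter]
  have h2 : ∑ p : (Fin m → Bool) × (Fin m → Bool), (if Q (subcubeMerge S p.1 p.2) then 1 else 0)
      = ∑ p : (Fin m → Bool) × (Fin m → Bool), (if Q p.1 then 1 else 0) :=
    Fintype.sum_equiv (mergeSwap S) _ _ (fun p => rfl)
  have h3 : ∑ p : (Fin m → Bool) × (Fin m → Bool), (if Q p.1 then 1 else 0) = 2 ^ m * (univ.filter Q).card := by
    rw [Fintype.sum_prod_type]
    have inner : ∀ a : Fin m → Bool, (∑ _b : Fin m → Bool, (if Q a then (1 : ℕ) else 0)) = 2 ^ m * (if Q a then 1 else 0) := by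
      intro a
      rw [Finset.sum_const, Finset.card_univ, smul_eq_mul, Fintype.card_fun, Fintype.card_bool, Fintype.card_fin]
    rw [Finset.sum_congr rfl (fun a _ => inner a), ← Finset.mul_sum, Finset.card_filter]
  rw [h1, h2, h3]

end RingCond

end AffBells23

end Summit.QuantumAdvantage.AdviceFreeQNC0
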